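import Literature.AnabelianGeometry.EtaleTheta.SettingModelSlice2Transversal
import HarnessLib

/-!
# (L3′) slice 2, file 13/13 — the Schreier steps for `T′`; THEOREM R2 (`theoremR2`) and COROLLARY (L3′) (`Original.corollaryL3`, `OriginalSlim.corollaryL3`, extension clause) for every `l` — unconditional

Part of the (L3′) slice-2 chain (abc-iut-L6-t19; FILING SHAPE derived from scratch v5 `Slice2TheoremR2ScratchV5.lean`
551b982286441a66 by the edits E1–E4/D1–D3/H1–H2 of FILING-PLAN-SLICE2.md 9643c7e42a42ad24 and the OPTION-L re-cut of §F v1.19gz (W):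
one definitions file + twelve theorem files).  Classical profinite group theory about OUR semi-synthetic `F₂hatT`; the objects and laws
are those of the one-sentence residual of record (cf. [EtTh] §1, §2 for the role they play there — nothing of [EtTh]/[IUTchII]/[IUTchIII]
in print is asserted; no side on [IUTchIII] Cor. 3.12; MORATORIUM (E): no application to `hext_at_iff_exists_f2hatAut_of_eq`).
-/

noncomputable section

open scoped Pointwise

namespace Literature.AnabelianGeometry.EtaleTheta.SettingModel.Slice2

open Literature.AnabelianGeometry.EtaleTheta.SettingModel
open Literature.AnabelianGeometry.EtaleTheta (ZHatLevel.level ZHatLevel.levelChar)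
open Literature.AnabelianGeometry.SemiGraphs (GQp)
open Literature.AnabelianGeometry.AbsoluteAnabelian
open Literature.AnabelianGeometry.AbsoluteAnabelian.AbsTopII
open _root_.Topology

/-! ### The Schreier steps for `T′` -/

section CompositeSteps

variable {p : ℕ} [Fact p.Prime] {l : ℕ+} {U₀ : Subgroup (GQp p)} {m : ℕ+} {f' : F₂hatT} {Ψ : F₂hatT → F₂hatT}

/-- Step `b^{±1}`: the generator is `1` or the parallel cusp `ξ_{x,s}^{(±l/(x,l))}`. [cite: MochizukiEtTh2009, §1 p.12] -/
theorem AxisPinned.step_b (H : AxisPinned p l U₀ m f' Ψ) [U₀.FiniteIndex] {x s i : ℤ}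
    (h1 : 0 ≤ x) (h2 : x ≤ (l : ℤ) - 1) (h3 : 0 ≤ s) (h4 : s < (Int.gcd x l : ℤ)) (h5 : 0 ≤ i)
    (h6 : i < (l : ℤ) / (Int.gcd x l : ℤ)) (ε : ℤ) (hε : ε = 1 ∨ ε = -1) (c : F₂) (hc : c = (FreeGroup.of 1 : F₂) ^ ε) :
    ∃ t' ∈ transT l, rep x s i * c * t'⁻¹ ∈ H.res.fixedWords := by
  subst hc
  by_cases hin : 0 ≤ i + ε ∧ i + ε < (l : ℤ) / (Int.gcd x l : ℤ)
  · refine ⟨rep x s (i + ε), rep_mem_transT h1 h2 h3 h4 hin.1 hin.2, ?_⟩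
    refine H.res.mem_fixedWords_of_eq (y := 1) ?_ (one_mem _) H.res.psi_one
    rw [show rep x s i * (FreeGroup.of 1 : F₂) ^ ε * (rep x s (i + ε))⁻¹ = 1 by simp only [rep]; group, map_one]
  · have hdvd := dvd_mul_mul_div_gcd l x ε
    set e : ℤ := (l : ℤ) / (Int.gcd x l : ℤ) with he
    have hi' : 0 ≤ i + ε - ε * e ∧ i + ε - ε * e < e := by rcases hε with rfl | rfl <;> omega
    refine ⟨rep x s (i + ε - ε * e), rep_mem_transT h1 h2 h3 h4 hi'.1 hi'.2, ?_⟩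
    have hvU : betaPow (ZHatLevel.eta x) (ZHatLevel.eta (ε * e)) ∈ Uhat l := by
      rw [betaPow_mem_Uhat_iff, toAdd_level_eta, toAdd_level_eta]
      have := (ZMod.intCast_zmod_eq_zero_iff_dvd (x * (ε * e)) l).2 hdvd
      push_cast at this ⊢
      exact this
    have hfix := (H.psi_parallel x (ZHatLevel.eta s)).1 _ hvU
    refine H.res.mem_fixedWords_of_eq ?_ (xiC_mem_Uhat hvU) hfix
    rw [xiC, betaPow_eta_eta, betaPow_eta_eta]
    simp only [rep, map_mul, map_inv, map_zpow]
    group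

/-- Step `a`: the generator is `u_{x,s} · W` with `W` a four-syllable word of `P_x`, or `A` at `x = l − 1`.
[cite: MochizukiEtTh2009, §1 p.12] -/
theorem AxisPinned.step_a (H : AxisPinned p l U₀ m f' Ψ) [U₀.FiniteIndex]
    {x s i : ℤ} (h1 : 0 ≤ x) (h2 : x ≤ (l : ℤ) - 1) (h3 : 0 ≤ s) (h4 : s < (Int.gcd x l : ℤ)) (h5 : 0 ≤ i)
    (h6 : i < (l : ℤ) / (Int.gcd x l : ℤ)) (c : F₂) (hc : c = (FreeGroup.of 0 : F₂) ^ (1 : ℤ)) :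
    ∃ t' ∈ transT l, rep x s i * c * t'⁻¹ ∈ H.res.fixedWords := by
  subst hc
  by_cases hx : x + 1 ≤ (l : ℤ) - 1
  · obtain ⟨s', i', hs'0, hs'd, hi'0, hi'd, hz⟩ := exists_coords l (x + 1) ((x - 1) * s + x * i)
    refine ⟨rep (x + 1) s' i', rep_mem_transT (by omega) hx hs'0 hs'd hi'0 hi'd, ?_⟩
    have hWU : betaPow (ZHatLevel.eta (x + 1)) (ZHatLevel.eta (-s)) * betaPow (ZHatLevel.eta x) (ZHatLevel.eta (2 * s + i)) *
        betaPow (ZHatLevel.eta (x + 1)) (ZHatLevel.eta (-i')) * betaPow (ZHatLevel.eta x) (ZHatLevel.eta (-s')) ∈ Uhat l := by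
      rw [betaPow_mul4_mem_Uhat_iff]
      simp only [toAdd_level_eta]
      have := (ZMod.intCast_zmod_eq_zero_iff_dvd _ l).2 hz
      push_cast at this ⊢
      linear_combination -this
    have hWP : (aPow (ZHatLevel.eta x))⁻¹ * (betaPow (ZHatLevel.eta (x + 1)) (ZHatLevel.eta (-s)) *
        betaPow (ZHatLevel.eta x) (ZHatLevel.eta (2 * s + i)) * betaPow (ZHatLevel.eta (x + 1)) (ZHatLevel.eta (-i')) *
        betaPow (ZHatLevel.eta x) (ZHatLevel.eta (-s'))) * aPow (ZHatLevel.eta x) ∈ DehnTwist.vertGp :=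
      conj_mul4_mem_vertGp (conj_betaPow_eta_succ_mem_vertGp _ _) (conj_betaPow_mem_vertGp _ _)
        (conj_betaPow_eta_succ_mem_vertGp _ _) (conj_betaPow_mem_vertGp _ _)
    have hWfix := H.psi_fourSyllable (x + 1) x (ZHatLevel.eta (-s)) (ZHatLevel.eta (2 * s + i))
      (ZHatLevel.eta (-i')) (ZHatLevel.eta (-s')) x hWU hWP
      (fun σ hσ => by
        have := (H.psi_parallel x (ZHatLevel.eta s)).2.1 _
          (betaPow_chi_div_mem_Uhat hσ (ZHatLevel.eta x) (ZHatLevel.eta (2 * s + i)))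
        rwa [xiC', eta_inv s] at this)
      (fun σ hσ => by
        have := (H.psi_parallel (x + 1) (ZHatLevel.eta s')).1 _
          (betaPow_chi_div_mem_Uhat hσ (ZHatLevel.eta (x + 1)) (ZHatLevel.eta (-i')))
        rw [xiC, add_sub_cancel_right] at this
        rwa [← eta_inv s', betaPow_inv, inv_inv])
    have hu := (H.psi_parallel x (ZHatLevel.eta s)).2.2
    have hUU := uElt_mem_Uhat (l := l) x (ZHatLevel.eta s)
    refine H.res.mem_fixedWords_of_eq ?_ (mul_mem hUU hWU) (by rw [H.res.mul _ hUU _ hWU, hu, hWfix])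
    rw [uElt_eta', betaPow_eta_eta, betaPow_eta_eta, betaPow_eta_eta, betaPow_eta_eta]
    simp only [rep, map_mul, map_inv, map_zpow]
    group
  · -- `x = l − 1`: the generator is `A`
    have hxl : x = (l : ℤ) - 1 := by omega
    subst hxl
    rw [gcd_pred_pnat] at h4
    have hs : s = 0 := by omega
    subst hs
    rw [gcd_pred_pnat, Int.ediv_one] at h6
    refine ⟨rep 0 i 0, rep_mem_transT le_rfl (by omega) h5 (by rw [gcd_zero_pnat]; exact h6) le_rfl
      (by rw [gcd_zero_pnat, Int.ediv_self (by exact_mod_cast l.ne_zero)]; exact zero_lt_one), ?_⟩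
    refine H.res.mem_fixedWords_of_eq (y := aPow (ZHatLevel.eta (l : ℤ))) ?_
      ((aPow_mem_Uhat_iff _).2 (level_eta_self l)) H.A_fixed
    rw [aPow_eta']
    simp only [rep, map_mul, map_inv, map_zpow, zpow_zero, mul_one, zero_sub, sub_zero]
    group

/-- Step `a⁻¹`: the generator is `W′ · u_{x−1,s′}⁻¹` with `W′` a four-syllable word of `P_{x−1}`, or `A⁻¹` at
`x = 0`. [cite: MochizukiEtTh2009, §1 p.12] -/
theorem AxisPinned.step_ainv (H : AxisPinned p l U₀ m f' Ψ) [U₀.FiniteIndex]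
    {x s i : ℤ} (h1 : 0 ≤ x) (h2 : x ≤ (l : ℤ) - 1) (h3 : 0 ≤ s) (h4 : s < (Int.gcd x l : ℤ)) (h5 : 0 ≤ i)
    (h6 : i < (l : ℤ) / (Int.gcd x l : ℤ)) (c : F₂) (hc : c = (FreeGroup.of 0 : F₂) ^ (-1 : ℤ)) :
    ∃ t' ∈ transT l, rep x s i * c * t'⁻¹ ∈ H.res.fixedWords := by
  subst hc
  by_cases hx : 1 ≤ x
  · obtain ⟨s', i', hs'0, hs'd, hi'0, hi'd, hz⟩ := exists_coords l (x - 1) ((x - 1) * s + x * i)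
    refine ⟨rep (x - 1) s' i', rep_mem_transT (by omega) (by omega) hs'0 hs'd hi'0 hi'd, ?_⟩
    have hWU : betaPow (ZHatLevel.eta (x - 1)) (ZHatLevel.eta s) * betaPow (ZHatLevel.eta x) (ZHatLevel.eta i) *
        betaPow (ZHatLevel.eta (x - 1)) (ZHatLevel.eta (-(i' + 2 * s'))) * betaPow (ZHatLevel.eta x) (ZHatLevel.eta s') ∈
        Uhat l := by
      rw [betaPow_mul4_mem_Uhat_iff]
      simp only [toAdd_level_eta]
      have := (ZMod.intCast_zmod_eq_zero_iff_dvd _ l).2 hz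
      push_cast at this ⊢
      linear_combination -this
    have hWP : (aPow (ZHatLevel.eta (x - 1)))⁻¹ * (betaPow (ZHatLevel.eta (x - 1)) (ZHatLevel.eta s) *
        betaPow (ZHatLevel.eta x) (ZHatLevel.eta i) * betaPow (ZHatLevel.eta (x - 1)) (ZHatLevel.eta (-(i' + 2 * s'))) *
        betaPow (ZHatLevel.eta x) (ZHatLevel.eta s')) * aPow (ZHatLevel.eta (x - 1)) ∈ DehnTwist.vertGp :=
      conj_mul4_mem_vertGp (conj_betaPow_mem_vertGp _ _) (conj_betaPow_eta_pred_mem_vertGp _ _)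
        (conj_betaPow_mem_vertGp _ _) (conj_betaPow_eta_pred_mem_vertGp _ _)
    have hWfix := H.psi_fourSyllable (x - 1) x (ZHatLevel.eta s) (ZHatLevel.eta i)
      (ZHatLevel.eta (-(i' + 2 * s'))) (ZHatLevel.eta s') (x - 1) hWU hWP
      (fun σ hσ => by
        have := (H.psi_parallel x (ZHatLevel.eta s)).1 _
          (betaPow_chi_div_mem_Uhat hσ (ZHatLevel.eta x) (ZHatLevel.eta i))
        rwa [xiC] at this)
      (fun σ hσ => by
        have := (H.psi_parallel (x - 1) (ZHatLevel.eta s')).2.1 _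
          (betaPow_chi_div_mem_Uhat hσ (ZHatLevel.eta (x - 1)) (ZHatLevel.eta (-(i' + 2 * s'))))
        rwa [xiC', sub_add_cancel, betaPow_inv, inv_inv] at this)
    have hu := (H.psi_parallel (x - 1) (ZHatLevel.eta s')).2.2
    have hUU := uElt_mem_Uhat (l := l) (x - 1) (ZHatLevel.eta s')
    refine H.res.mem_fixedWords_of_eq ?_ (mul_mem hWU (inv_mem hUU))
      (by rw [H.res.mul _ hWU _ (inv_mem hUU), H.res.psi_inv hUU, hu, hWfix])
    rw [uElt_eta', betaPow_eta_eta, betaPow_eta_eta, betaPow_eta_eta, betaPow_eta_eta]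
    simp only [rep, map_mul, map_inv, map_zpow]
    group
  · -- `x = 0`: the generator is `A⁻¹`
    have hx0 : x = 0 := by omega
    subst hx0
    rw [gcd_zero_pnat, Int.ediv_self (by exact_mod_cast l.ne_zero)] at h6
    have hi : i = 0 := by omega
    subst hi
    rw [gcd_zero_pnat] at h4
    refine ⟨rep ((l : ℤ) - 1) 0 s, rep_mem_transT (by have := l.pos; omega) le_rfl le_rfl
      (by rw [gcd_pred_pnat]; exact zero_lt_one) h3 (by rw [gcd_pred_pnat, Int.ediv_one]; exact h4), ?_⟩
    have hAU : aPow (ZHatLevel.eta (l : ℤ)) ∈ Uhat l := (aPow_mem_Uhat_iff _).2 (level_eta_self l)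
    refine H.res.mem_fixedWords_of_eq (y := (aPow (ZHatLevel.eta (l : ℤ)))⁻¹) ?_ (inv_mem hAU)
      (by rw [H.res.psi_inv hAU, H.A_fixed])
    rw [aPow_eta']
    simp only [rep, map_mul, map_inv, map_zpow, zpow_zero, mul_one, zero_sub, sub_zero]
    group

/-- **All Schreier generators of `T′` are fixed** (every `l`). [cite: MochizukiEtTh2009, §1 p.12] -/
theorem AxisPinned.transversal_step (H : AxisPinned p l U₀ m f' Ψ) [U₀.FiniteIndex] :
    ∀ t ∈ transT l, ∀ c : F₂, (c = (FreeGroup.of 0 : F₂) ∨ c = (FreeGroup.of 1 : F₂) ∨ c = (FreeGroup.of 0 : F₂)⁻¹ ∨ c = (FreeGroup.of 1 : F₂)⁻¹) →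
      ∃ t' ∈ transT l, t * c * t'⁻¹ ∈ H.res.fixedWords := by
  intro t ht c hc
  obtain ⟨x, s, i, h1, h2, h3, h4, h5, h6, rfl⟩ := ht
  rcases hc with rfl | rfl | rfl | rfl
  · exact H.step_a h1 h2 h3 h4 h5 h6 _ (zpow_one _).symm
  · exact H.step_b h1 h2 h3 h4 h5 h6 1 (Or.inl rfl) _ (zpow_one _).symm
  · exact H.step_ainv h1 h2 h3 h4 h5 h6 _ (zpow_neg_one _).symm
  · exact H.step_b h1 h2 h3 h4 h5 h6 (-1) (Or.inr rfl) _ (zpow_neg_one _).symm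

end CompositeSteps

/-! ## §20 THEOREM R2 AND COROLLARY (L3′) FOR EVERY `l` -/

section FinalAll

variable {p : ℕ} [Fact p.Prime] {l : ℕ+} {U₀ : Subgroup (GQp p)} {m : ℕ+} {f' : F₂hatT} {Ψ : F₂hatT → F₂hatT}

/-- **`Ψ′ ∘ η = η` on `U_d`** (every `l`). [cite: MochizukiEtTh2009, §1 p.12] -/
theorem AxisPinned.psi_eta (H : AxisPinned p l U₀ m f' Ψ) [U₀.FiniteIndex]
    (g : F₂) (hg : eta g ∈ Uhat l) : Ψ (eta g) = eta g := by
  have hle : Ud l ≤ H.res.fixedWords :=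
    le_of_transversal _ _ (transT l) one_mem_transT (H.transversal_step) (fun g hg => hg.1)
      (fun t ht htU => eq_one_of_mem_transT_of_mem_Ud ht htU)
  exact (hle hg).2

/-- **`Ψ′ = id` on `Û_l`** (normalised case, every `l`), by density. [cite: MochizukiEtTh2009, §1 p.12] -/
theorem AxisPinned.psi_eq_self (H : AxisPinned p l U₀ m f' Ψ) [U₀.FiniteIndex]
    {x : F₂hatT} (hx : x ∈ Uhat l) : Ψ x = x := by
  have hE : IsClosed {y : Uhat l | Ψ y = (y : F₂hatT)} := isClosed_eq H.res.cont continuous_subtype_val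
  have hD : Dense {y : Uhat l | (y : F₂hatT) ∈ Set.range eta} := by
    rw [dense_iff_inter_open]
    rintro V hV ⟨y, hy⟩
    obtain ⟨W, hW, rfl⟩ := isOpen_induced_iff.mp hV
    have hWU : IsOpen (W ∩ (Uhat l : Set F₂hatT)) := hW.inter isOpen_Uhat
    obtain ⟨g, hgWU⟩ := denseRange_eta.exists_mem_open hWU ⟨y, hy, y.2⟩
    exact ⟨⟨eta g, hgWU.2⟩, hgWU.1, g, rfl⟩
  have hsub : {y : Uhat l | (y : F₂hatT) ∈ Set.range eta} ⊆ {y : Uhat l | Ψ y = (y : F₂hatT)} := by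
    rintro y ⟨g, hg⟩
    change Ψ y = y
    rw [← hg]
    exact H.psi_eta g (by rw [hg]; exact y.2)
  have huniv : {y : Uhat l | Ψ y = (y : F₂hatT)} = Set.univ := by
    have := (hD.mono hsub).closure_eq
    rwa [hE.closure_eq] at this
  have : (⟨x, hx⟩ : Uhat l) ∈ {y : Uhat l | Ψ y = (y : F₂hatT)} := by rw [huniv]; trivial
  exact this

/-- **THEOREM R2 (EVERY `l`; kernel form).**  Let `Ψ′ : Û_l → f′⁻¹ Û_l f′` satisfy the ONE-SENTENCE RESIDUAL OF
RECORD (`Residual`).  Then — UNCONDITIONALLY, the slice-1 statements Thm R1 / Cor R1′ being supplied by the landed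
`Slice1.thetaFixedRigidityOn_holds` / `Slice1.torusStable_holds` — `Ψ′ = id` on `Û_l` or `Ψ′ = σ̂` on `Û_l`; `f′`
normalises `Û_l`; and the unipotent law holds on the nose.  KERNEL ROUTE: the axis is pinned (§9–§12), the end
vertices are cusp-diagonal (§13), and the generation step is done for every `l` via the transversal `T_l` (§16, §19),
the parallel cusps / letters `u_{x,s}` (§14′) and four-syllable rigidity (§19).  [cite: MochizukiEtTh2009, §1 p.12] -/
theorem theoremR2 (h : Residual p l U₀ m f' Ψ) [U₀.FiniteIndex] :
    ((∀ x ∈ Uhat l, Ψ x = x) ∨ (∀ x ∈ Uhat l, Ψ x = sigmaHat x)) ∧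
      (∀ y : F₂hatT, f' * y * f'⁻¹ ∈ Uhat l ↔ y ∈ Uhat l) ∧
      (∀ k : ZH, ∀ x ∈ Uhat l, Ψ (Dp (k ^ (m : ℕ)) x) = Dp (k ^ (m : ℕ)) (Ψ x)) := by
  rcases h.axisPinned_or with H | H
  · exact ⟨Or.inl fun x hx => H.psi_eq_self hx, H.normal, H.dexact⟩
  · refine ⟨Or.inr fun x hx => ?_, fun y => ?_, fun k x hx => ?_⟩
    · have hσ : sigmaHat (Ψ x) = x := H.psi_eq_self hx
      calc Ψ x = sigmaHat (sigmaHat (Ψ x)) := (sigmaHat_sigmaHat _).symm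
        _ = sigmaHat x := by rw [hσ]
    · have := H.normal (sigmaHat y)
      rw [← map_inv sigmaHat, ← map_mul, ← map_mul, sigmaHat_mem_Uhat_iff, sigmaHat_mem_Uhat_iff] at this
      exact this
    · have h1 : sigmaHat (Ψ (Dp (k ^ (m : ℕ)) x)) = Dp (k ^ (m : ℕ)) (sigmaHat (Ψ x)) := H.dexact k x hx
      have e := congrArg sigmaHat h1
      rw [sigmaHat_sigmaHat, sigmaHat_Dp, sigmaHat_sigmaHat] at e
      exact e

/-- **COROLLARY (L3′) (EVERY `l`).**  Under the ORIGINAL hypotheses (`Original`) — UNCONDITIONALLY, the slice-1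
statements being supplied by the landed `Slice1.*_holds` (Prop R1b in line form: `Slice1.exists_torusNormalForm_holds`):
there is `f ∈ F̂₂` normalising `Û_l` with `Ψ = Inn(f)` or `Ψ = Inn(f) ∘ σ̂` on `Û_l`.
[cite: MochizukiEtTh2009, §1 p.12] -/
theorem Original.corollaryL3 (h : Original p l U₀ m Ψ)
    [hU : U₀.FiniteIndex] :
    ∃ f : F₂hatT, (∀ y : F₂hatT, f * y * f⁻¹ ∈ Uhat l ↔ y ∈ Uhat l) ∧
      ((∀ x ∈ Uhat l, Ψ x = f * x * f⁻¹) ∨ (∀ x ∈ Uhat l, Ψ x = f * sigmaHat x * f⁻¹)) := by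
  obtain ⟨η, hηcoc, hη⟩ := h.torus
  obtain ⟨f, hf1, hf2, -, -⟩ := Slice1.exists_torusNormalForm_holds p U₀ η hηcoc h.lineMap (h.lineMap_B) (h.lineMap_inj) (h.lineMap_surj)
    (fun v hv x => h.lineMap_twist hη v hv x)
  have hres := h.residual_of_normalForm hη hf1 hf2
  obtain ⟨hid, hnorm, -⟩ := theoremR2 hres
  refine ⟨f, hnorm, ?_⟩
  rcases hid with e | e
  · left; intro x hx
    have := e x hx
    calc Ψ x = f * (f⁻¹ * Ψ x * f) * f⁻¹ := by group
      _ = f * x * f⁻¹ := by rw [this]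
  · right; intro x hx
    have := e x hx
    calc Ψ x = f * (f⁻¹ * Ψ x * f) * f⁻¹ := by group
      _ = f * sigmaHat x * f⁻¹ := by rw [this]

end FinalAll

/-! ## §21 (cont.) COROLLARY (L3′) from the slim hypotheses -/

section SlimnessCorollary

variable {p : ℕ} [Fact p.Prime] {l : ℕ+} {U₀ : Subgroup (GQp p)} {m : ℕ+} {Ψ : F₂hatT → F₂hatT}

/-- **COROLLARY (L3′), slim hypotheses, every `l`.** [cite: MochizukiEtTh2009, §1 p.12] -/
theorem OriginalSlim.corollaryL3 (h : OriginalSlim p l U₀ m Ψ)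
    [U₀.FiniteIndex] :
    ∃ f : F₂hatT, (∀ y : F₂hatT, f * y * f⁻¹ ∈ Uhat l ↔ y ∈ Uhat l) ∧
      ((∀ x ∈ Uhat l, Ψ x = f * x * f⁻¹) ∨ (∀ x ∈ Uhat l, Ψ x = f * sigmaHat x * f⁻¹)) :=
  h.toOriginal.corollaryL3

end SlimnessCorollary

/-! ## §22 (cont.) THE EXTENSION CLAUSE OF (L3′) -/

section ExtensionClause

variable {p : ℕ} [Fact p.Prime] {l : ℕ+} {U₀ : Subgroup (GQp p)} {m : ℕ+} {Ψ : F₂hatT → F₂hatT}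

/-- **(L3′), extension clause (every `l`)**: under the ORIGINAL laws, `Ψ|_{Û_l}` is the restriction of a topological
automorphism `Φ` of `F̂₂` with `Φ(Û_l) = Û_l` — `Φ = Inn(f)` or `Inn(f) ∘ σ̂`. [cite: MochizukiEtTh2009, §1 p.12] -/
theorem Original.extends (h : Original p l U₀ m Ψ) [U₀.FiniteIndex] :
    ∃ Φ : F₂hatT ≃ₜ* F₂hatT, (∀ y : F₂hatT, Φ y ∈ Uhat l ↔ y ∈ Uhat l) ∧ ∀ x ∈ Uhat l, Ψ x = Φ x := by
  obtain ⟨f, hf, hΨ⟩ := h.corollaryL3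
  rcases hΨ with e | e
  · exact ⟨innEquiv f, fun y => by rw [innEquiv_apply]; exact hf y, fun x hx => by rw [innEquiv_apply]; exact e x hx⟩
  · refine ⟨sigmaHatEquiv.trans (innEquiv f), fun y => ?_, fun x hx => ?_⟩
    · show f * sigmaHat y * f⁻¹ ∈ Uhat l ↔ y ∈ Uhat l
      rw [hf, sigmaHat_mem_Uhat_iff]
    · show Ψ x = f * sigmaHat x * f⁻¹
      exact e x hx

/-- The same from the SLIM hypotheses. [cite: MochizukiEtTh2009, §1 p.12] -/
theorem OriginalSlim.extends (h : OriginalSlim p l U₀ m Ψ)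
    [U₀.FiniteIndex] :
    ∃ Φ : F₂hatT ≃ₜ* F₂hatT, (∀ y : F₂hatT, Φ y ∈ Uhat l ↔ y ∈ Uhat l) ∧ ∀ x ∈ Uhat l, Ψ x = Φ x :=
  h.toOriginal.extends

end ExtensionClause

end Literature.AnabelianGeometry.EtaleTheta.SettingModel.Slice2

end
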